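/-
Copyright: statement-level skeleton of a published paper (lit-balaban cell, Phase-2 proof seat p39 gen 7). No proof claims
beyond what the kernel checks below.
-/
import Literature.MathematicalPhysics.QuantumFieldTheory.Balaban1983to89.B3MxiFubiniBound
import Literature.MathematicalPhysics.QuantumFieldTheory.Balaban1983to89.B3Eq326GraphKernelParts

/-!
# B3 — T. Bałaban, *(Higgs)₂,₃ quantum fields in a finite volume. III. Renormalization*, CMP **88** (1983) 411–445
[Balaban1983Higgs3], p. 441 [PDF 31]: the replacement of the propagator in the vector self-energy function `Π_{μμ′}` of (3.26)
(the square bracket; degree `−d + 2 = −1` at `d = 3`), verbatim: *"Next we replace the propagator G_{j₀}(0) by C^ξ, ξ = L^{−j₀},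
using the same equation as in (3.16). If at least one propagator G_{j₀}(0) is replaced by G_{j₀}(0)(1 − m²_{j₀} − a_{j₀}P_{j₀})C^ξ,
then we get a convergent expression. Hence it is enough to consider the expressions with the propagator C^ξ only."* — PROVED for
r15's `B3Sect3VectorSelfEnergy.Pi2` (= Π_{μμ′}) AT THE ZERO-FIELD TORUS INSTANCE, `d = 3`: with `M = G^ξ_k(0) − C^ξ_T` every one of
the (3.26) graphs of `Π_{μμ′}` containing at least one `M` is bounded by `Cst·|tr q²|` uniformly in the volume and in `k`, hence
`|Π_{μμ′}[G^ξ_k(0)](y) − Π_{μμ′}[C^ξ_T](y)| ≤ Cst·|tr q²|`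

statement-level skeleton of published theorems with citation tags; proofs where landed; nothing here is a claim about
the Yang–Mills mass gap

PDF held: `paper:balaban1983-higgs-2-3-quantum-fields-finite-volume` (journal page = PDF page + 410); pp. 440–441 read on the ×2
renders `run/shared/lean/pub/pub-balaban/b2b-balaban-ref1/pages/1983-cmp88-higgs23-III/1983-cmp88-higgs23-III-p030-x2.png`,
`…-p031-x2.png`.  Row **B3.Eq3.25-3.32** of `HOME/lit-balaban-r15/ROWS-B3.md` (fold owner r15).  WHY THIS IS HARDER THAN `Π_{μμ′ν}`
(`B3Pi3CrossTermsZeroTorus`): without the displacement factor the graphs `(M∂^*_{μ′})(y,x′)(C∂^*_μ)(x′,y)` and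
`M(y,x′)(∂_{μ′}C∂^*_μ)(x′,y)` are products of kernels of total singularity `|y−x′|^{−3}`, NOT absolutely summable factor by factor;
they are handled (i) by p. 441's *"integration by parts formula"* in `x′` (`B3Eq326GraphKernelParts.sum_kerA_parts/sum_kerB_parts`),
which trades them for `C(y,x′+e_{μ′})(∂_{μ′}M∂^*_μ)(x′,y)` — summable because the MIXED difference of `M` is one degree better
than a propagator's (`B3MxiDifferenceProfiles.abs_d2Kernel_Mxi_le`, the lattice Riesz composition `conv22_le`) — and for
`(M∂^*_{μ′})(y,x′)(C∂^*_μ)(x′+e_{μ′},y)`, and (ii) by the FUBINI form `B3MxiFubiniBound.abs_sum_dAdjMxi_mul_le` (the `x′`-sum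
inside `M = ξ^dG(0)DC` done first).  Inputs BY NAME: `G0xi_all_bounds`, `Mxi_profiles`, `abs_CxiT_profile`, `dAdjKernel_CxiT_profile`,
`G0xi_eq_CxiT_add_Mxi`, `B3Eq326GraphKernelParts.{sum_term_le₂, abs_sum_kerC_le, sum_mul_pull, profile_shift_le, supDist_shift_le_one,
Pi2_add_sub}`.
* §1 `G0xi_eq_add` (`G^ξ_k(0) = C^ξ_T + M` as kernels), `sum_kerC_add_left/right`.
* §2 **`Pi2_graphs_with_M_le`**: `∃ Cst > 0` uniform in `P = (3,L,m,K)`, `1 ≤ k ≤ K`: the three nonlocal graph sums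
  `Σ_{x′}ξ^d·kerC[X,Y](y,x′)` with `[X,Y] = [M,M], [M,C], [C,M]` and the two local terms `τM(y,y)`, `τξ(M∂^*_μ)(y,y)` are `≤ Cst·|τ|`;
  `Pi2_graphs_with_M_le'` adds `[M,G], [G,M], [G,G] − [C,C]` by bilinearity.
* §3 **`Pi2_G0xi_sub_CxiT`**: `|Π_{μμ′}[G,G,G](y) − Π_{μμ′}[C,C,C](y)| ≤ Cst·|tr q²|` (`Π = B3Sect3VectorSelfEnergy.Pi2 ξ τ`).
HONEST SCOPE: the model instance `A = B̃ = 0`, `U ≡ 1`, `Ω` = the whole torus, `d = 3`, on the `ξ = L^{−k}` lattice (the rescaled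
`Π^{(L^{−j₀},j₀)}_{μμ′}`; the `η`-lattice original carries the extra factor `(L^{j₀}η)^{−d+2}`, r15's `Pi2_rescale` — the printed
`−d + 2 = −1` divergence degree is that factor, not touched here); constants existential (functions of `L, a, m²`).  The evaluation
(3.29)–(3.32) of the pure-`C^ξ` function is NOT touched here.  Mathlib + the cited tree files only; theorems only, no definitions,
no named facts; standard axioms.  Unit `lit-balaban-p39-g7` (Phase-2 proof seat p39, gen 7), HOME `run/shared/lean/pub/lit-balaban/`,
2026-08-21.
-/

open scoped BigOperators

namespace Literature.MathematicalPhysics.QuantumFieldTheory.Balaban1983to89.B3Pi2CrossTermsZeroTorus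

open Matrix Finset B1RG242Torus B3GkZeroTorusRescaled B3Eq316ResolventZeroTorus B3KernelConvolutionTorus
open B3KernelConvolutionTorusSup B3Bound316ZeroTorus B3Eq323CrossTermsZeroTorus
open LatticeFieldCalculus B3Sect3ScalarSelfEnergy B3TorusRadialSums B3Bound316 B3CxiTorusBound
open B3ZeroTorusKernelProfiles B3MxiDifferenceProfiles B3MxiFubiniBound B3Eq326GraphKernelParts
open B3Sect3VectorSelfEnergy (dAdjKernel d2Kernel kerA kerB kerC Pi2)

noncomputable section

variable {P : Params} {j : ℕ}

/-! ## §1 Algebra -/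

/-- `G^ξ_k(0) = C^ξ_T + M` as kernels. [cite: Balaban1983Higgs3, (3.16) p.437] -/
theorem G0xi_eq_add (a msq : ℝ) (k : ℕ) : G0xi P a msq k = CxiT (P.eta k) + Mxi P a msq k := by
  funext y y'; exact G0xi_eq_CxiT_add_Mxi a msq k y y'

/-- kernel: the (3.26) graph sum is additive in the first slot. [cite: Balaban1983Higgs3, (3.26) p.440] -/
theorem sum_kerC_add_left (w η τ : ℝ) (X X' Y : Kernel P j) (μ μ' : Fin P.d) (x : Site P j) :
    ∑ x' : Site P j, w * kerC η τ (X + X') Y μ μ' x x' =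
      (∑ x' : Site P j, w * kerC η τ X Y μ μ' x x') + ∑ x' : Site P j, w * kerC η τ X' Y μ μ' x x' := by
  rw [← Finset.sum_add_distrib]
  refine Finset.sum_congr rfl fun x' _ => ?_
  simp only [kerC, kerA, kerB, dAdjKernel, d2Kernel, Pi.add_apply]; ring

/-- kernel: the (3.26) graph sum is additive in the second slot. [cite: Balaban1983Higgs3, (3.26) p.440] -/
theorem sum_kerC_add_right (w η τ : ℝ) (X Y Y' : Kernel P j) (μ μ' : Fin P.d) (x : Site P j) :
    ∑ x' : Site P j, w * kerC η τ X (Y + Y') μ μ' x x' =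
      (∑ x' : Site P j, w * kerC η τ X Y μ μ' x x') + ∑ x' : Site P j, w * kerC η τ X Y' μ μ' x x' := by
  rw [← Finset.sum_add_distrib]
  refine Finset.sum_congr rfl fun x' _ => ?_
  simp only [kerC, kerA, kerB, dAdjKernel, d2Kernel, Pi.add_apply]; ring

/-- kernel: drop the exponential of a profile bound. [folklore] -/
private theorem drop_exp {v c q t : ℝ} (hc : 0 ≤ c) (hq : 0 ≤ q) (ht : 0 ≤ t) (h : v ≤ c * (q * Real.exp (-t))) : v ≤ c * q :=
  h.trans (mul_le_mul_of_nonneg_left (mul_le_of_le_one_right hq (Real.exp_le_one_iff.mpr (by linarith))) hc)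

/-! ## §2 The graphs with at least one `M` -/

/-- **p. 441, "If at least one propagator `G_{j₀}(0)` is replaced by `G_{j₀}(0)(1 − m²_{j₀} − a_{j₀}P_{j₀})C^ξ`, then we get a
convergent expression" — for `Π_{μμ′}` at the zero-field torus instance.**  For odd `L > 1`, `a > 0`, `m² ≥ 0` there is `Cst > 0`
(a function of `L, a, m²`) such that for every `P = (3, L, m, K)`, every `1 ≤ k ≤ K` (`ξ = L^{−k}`, `C = C^ξ_T`, `M = G^ξ_k(0) − C`),
every `τ = tr q²` and all `μ, μ′, y`: the three nonlocal graph sums `Σ_{x′}ξ^d·kerC[X,Y]_{μμ′}(y,x′)` with `[X,Y] = [M,M], [M,C],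
[C,M]` (`kerC = tr q²[−(X∂^*_{μ′})(y,x′)(Y∂^*_μ)(x′,y) + X(y,x′)(∂_{μ′}Y∂^*_μ)(x′,y)]`) and the two local terms `τM(y,y)`,
`τ·ξ(M∂^{ξ*}_μ)(y,y)` are bounded by `Cst·|τ|`. [cite: Balaban1983Higgs3, (3.26) pp.440–441, (3.16) p.437] -/
theorem Pi2_graphs_with_M_le (L : ℕ) (hL : Odd L ∧ 1 < L) {a : ℝ} (ha : 0 < a) {msq : ℝ} (hmsq : 0 ≤ msq) :
    ∃ Cst : ℝ, 0 < Cst ∧ ∀ (P : Params), P.d = 3 → P.L = L → ∀ k : ℕ, 1 ≤ k → k ≤ P.K →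
      ∀ (τ : ℝ) (μ μ' : Fin P.d) (y : Site P 0),
        |∑ x' : Site P 0, P.eta k ^ P.d * kerC (P.eta k) τ (Mxi P a msq k) (Mxi P a msq k) μ μ' y x'| ≤ Cst * |τ| ∧
        |∑ x' : Site P 0, P.eta k ^ P.d * kerC (P.eta k) τ (Mxi P a msq k) (CxiT (P.eta k)) μ μ' y x'| ≤ Cst * |τ| ∧
        |∑ x' : Site P 0, P.eta k ^ P.d * kerC (P.eta k) τ (CxiT (P.eta k)) (Mxi P a msq k) μ μ' y x'| ≤ Cst * |τ| ∧
        |τ * Mxi P a msq k y y| ≤ Cst * |τ| ∧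
        |τ * (P.eta k * dAdjKernel (P.eta k)⁻¹ μ (Mxi P a msq k) y y)| ≤ Cst * |τ| := by
  obtain ⟨δG, CG, hδG, hCG, HG⟩ := G0xi_all_bounds L hL ha hmsq
  obtain ⟨δM, CM, hδM, hCM, HM⟩ := Mxi_profiles L hL ha hmsq
  have hT := torusConst_nonneg
  set cT : ℝ := torusConst + 472501 with hcT
  set cT' : ℝ := 3037500 + torusConst + 472501 with hcT'
  have hcT0 : 0 ≤ cT := by rw [hcT]; linarith
  have hcT0' : 0 ≤ cT' := by rw [hcT']; linarith
  have hRM0 := radialConst_nonneg 3 hδM zero_le_one 0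
  have hRM1 := radialConst_nonneg 3 hδM zero_le_one 1
  have hγ : 0 < min δG (1 / 2) / 2 := by have := lt_min hδG (by norm_num : (0 : ℝ) < 1 / 2); positivity
  have hRγ := radialConst_nonneg 3 hγ zero_le_one 1
  have hRh := radialConst_nonneg 3 (by norm_num : (0 : ℝ) < 1 / 2) zero_le_one 0
  -- the Fubini constant (per unit `b`) and the six graph constants
  set KF : ℝ := (torusConst + 472501) *
      (((1 + msq) + a * (4 * Real.exp (4 * (min δG (1 / 2) / 2)) * 1 * (1 + radialConst 3 (min δG (1 / 2) / 2) 1 1) +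
          2 * Real.exp (2 * (min δG (1 / 2) / 2)) * 1)) * (6205 * CG)) * (1 + radialConst 3 (1 / 2) 1 0) with hKF
  have hKF0 : 0 ≤ KF := by positivity
  set K₁ : ℝ := CM * CM * (1 + radialConst 3 δM 1 0) + CM * CM * (1 + radialConst 3 δM 1 1) with hK₁
  set K₂ : ℝ := KF * cT' + KF * (cT' * (2 ^ 2 * Real.exp (1 / 2))) with hK₂
  set K₃ : ℝ := 2 * Real.exp (1 / 2) * cT * CM * (1 + radialConst 3 δM 1 0) + cT * CM * (1 + radialConst 3 δM 1 0)
    with hK₃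
  have hK₁0 : 0 ≤ K₁ := by positivity
  have hK₂0 : 0 ≤ K₂ := by positivity
  have hK₃0 : 0 ≤ K₃ := by positivity
  refine ⟨K₁ + K₂ + K₃ + CM + 1, by positivity, fun P hPd hPL k hk1 hkK τ μ μ' y => ?_⟩
  obtain ⟨-, hGr, -, -⟩ := HG P hPd hPL k hk1 hkK
  obtain ⟨hM0, -, hMa, hMm, -, -⟩ := HM P hPd hPL k hk1 hkK
  have hkm : k ≤ P.m + P.K := hkK.trans (Nat.le_add_left _ _)
  have hη : 0 < P.eta k := eta_pos P k
  have hη1 : P.eta k ≤ 1 := eta_le_one P k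
  have hN : 1 ≤ P.eta k * (P.sitesPerDir 0 : ℝ) := one_le_eta_mul_sitesPerDir P hkm
  have hτ := abs_nonneg τ
  have ht : ∀ (c : ℝ), 0 ≤ c → ∀ z : Site P 0, 0 ≤ c * (P.eta k * (supDist y z : ℝ)) := fun c hc z => by positivity
  -- pointwise bounds, first slot (no exponential), distances from `y`
  have fM0 : ∀ x' : Site P 0, |Mxi P a msq k y x'| ≤ CM * ((P.eta k * max (1 : ℝ) (supDist y x' : ℝ)) ^ 0)⁻¹ :=
    fun x' => by simpa using hM0 y x'
  have fMa : ∀ x' : Site P 0, |dAdjKernel (P.eta k)⁻¹ μ' (Mxi P a msq k) y x'| ≤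
      CM * ((P.eta k * max (1 : ℝ) (supDist y x' : ℝ)) ^ 1)⁻¹ := fun x' => by
    rw [pow_one]; exact drop_exp hCM.le (by positivity) (ht δM hδM.le x') (hMa μ' y x')
  have fCv : ∀ x' : Site P 0, |CxiT (P.eta k) y x'| ≤ cT * ((P.eta k * max (1 : ℝ) (supDist y x' : ℝ)) ^ 1)⁻¹ :=
    fun x' => by
    rw [pow_one]; exact drop_exp hcT0 (by positivity) (ht (1 / 2) (by norm_num) x') (abs_CxiT_profile hPd hη hη1 hN y x')
  have fCs : ∀ x' : Site P 0, |CxiT (P.eta k) y (x'.shift μ')| ≤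
      2 * Real.exp (1 / 2) * cT * ((P.eta k * max (1 : ℝ) (supDist y x' : ℝ)) ^ 1)⁻¹ := by
    intro x'
    have h1 := abs_CxiT_profile hPd hη hη1 hN y (x'.shift μ')
    rw [supDist_comm y (x'.shift μ')] at h1
    have h2 := profile_shift_le hη hη1 (by norm_num : (0 : ℝ) ≤ 1 / 2) 1 (supDist_shift_le_one x' μ') y
    rw [supDist_comm x' y] at h2
    simp only [pow_one] at h2 ⊢
    have h3 := h1.trans (mul_le_mul_of_nonneg_left h2 hcT0)
    have h4 : |CxiT (P.eta k) y (x'.shift μ')| ≤ (2 * Real.exp (1 / 2) * cT) *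
        ((P.eta k * max (1 : ℝ) (supDist y x' : ℝ))⁻¹ * Real.exp (-(1 / 2 * (P.eta k * (supDist y x' : ℝ))))) :=
      h3.trans (le_of_eq (by ring))
    exact drop_exp (by positivity) (by positivity) (ht (1 / 2) (by norm_num) x') h4
  -- second slot, read at `(x′, y)`
  have gMa : ∀ x' : Site P 0, |dAdjKernel (P.eta k)⁻¹ μ (Mxi P a msq k) x' y| ≤
      CM * (((P.eta k * max (1 : ℝ) (supDist y x' : ℝ)) ^ 1)⁻¹ * Real.exp (-(δM * (P.eta k * (supDist y x' : ℝ))))) :=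
    fun x' => by rw [supDist_comm y x', pow_one]; exact hMa μ x' y
  have gMm : ∀ x' : Site P 0, |d2Kernel (P.eta k)⁻¹ μ' μ (Mxi P a msq k) x' y| ≤
      CM * (((P.eta k * max (1 : ℝ) (supDist y x' : ℝ)) ^ 1)⁻¹ * Real.exp (-(δM * (P.eta k * (supDist y x' : ℝ))))) :=
    fun x' => by rw [supDist_comm y x', pow_one]; exact hMm μ' μ x' y
  -- the Fubini bound, with its constant in the form `KF · b`
  have hF : ∀ (b : ℝ), 0 ≤ b → ∀ κ : Kernel P 0, (∀ x' x : Site P 0, |κ x' x| ≤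
      b * (((P.eta k * max (1 : ℝ) (supDist x' x : ℝ)) ^ 2)⁻¹ * Real.exp (-(1 / 2 * (P.eta k * (supDist x' x : ℝ)))))) →
      |∑ x' : Site P 0, P.eta k ^ P.d * (dAdjKernel (P.eta k)⁻¹ μ' (Mxi P a msq k) y x' * κ x' y)| ≤ KF * b := by
    intro b hb κ hκ
    have h := abs_sum_dAdjMxi_mul_le hPd ha hmsq hk1 hkK hδG hCG.le hGr (by norm_num : (0 : ℝ) < 1 / 2) hb κ hκ μ' y
    exact h.trans (le_of_eq (by rw [hKF]; ring))
  -- N1, N2: the graphs [M,M]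
  have hN1 := sum_term_le₂ hPd hη hη1 hδM (p := 1) (q := 1) (i := 0) rfl (by norm_num) hCM.le hCM.le τ y _ _ fMa gMa
  have hN2 := sum_term_le₂ hPd hη hη1 hδM (p := 0) (q := 1) (i := 1) rfl (by norm_num) hCM.le hCM.le τ y _ _ fM0 gMm
  -- N3: (M∂^*)(C∂^*) by Fubini
  have hN3 : |∑ x' : Site P 0, P.eta k ^ P.d * (τ * (dAdjKernel (P.eta k)⁻¹ μ' (Mxi P a msq k) y x' *
      dAdjKernel (P.eta k)⁻¹ μ (CxiT (P.eta k)) x' y))| ≤ KF * cT' * |τ| := by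
    rw [sum_mul_pull, abs_mul]
    have h := hF cT' hcT0' (dAdjKernel (P.eta k)⁻¹ μ (CxiT (P.eta k)))
      (fun x' x => dAdjKernel_CxiT_profile hPd hη hη1 hN μ x' x)
    calc |τ| * _ ≤ |τ| * (KF * cT') := mul_le_mul_of_nonneg_left h hτ
      _ = KF * cT' * |τ| := by ring
  -- N4: M(∂C∂^*) by parts, then Fubini with the shifted column difference of C
  have hN4 : |∑ x' : Site P 0, P.eta k ^ P.d * (τ * (Mxi P a msq k y x' *
      d2Kernel (P.eta k)⁻¹ μ' μ (CxiT (P.eta k)) x' y))| ≤ KF * (cT' * (2 ^ 2 * Real.exp (1 / 2))) * |τ| := by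
    rw [sum_kerB_parts, abs_neg, sum_mul_pull, abs_mul]
    have h := hF (cT' * (2 ^ 2 * Real.exp (1 / 2))) (by positivity)
      (fun x' x => dAdjKernel (P.eta k)⁻¹ μ (CxiT (P.eta k)) (x'.shift μ') x) (fun x' x => by
        have h1 := dAdjKernel_CxiT_profile hPd hη hη1 hN μ (x'.shift μ') x
        have h2 := profile_shift_le hη hη1 (by norm_num : (0 : ℝ) ≤ 1 / 2) 2 (supDist_shift_le_one x' μ') x
        calc |dAdjKernel (P.eta k)⁻¹ μ (CxiT (P.eta k)) (x'.shift μ') x|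
            ≤ cT' * (2 ^ 2 * Real.exp (1 / 2) * (((P.eta k * max (1 : ℝ) (supDist x' x : ℝ)) ^ 2)⁻¹ *
                Real.exp (-(1 / 2 * (P.eta k * (supDist x' x : ℝ)))))) := h1.trans (mul_le_mul_of_nonneg_left h2 hcT0')
          _ = _ := by ring)
    calc |τ| * _ ≤ |τ| * (KF * (cT' * (2 ^ 2 * Real.exp (1 / 2)))) := mul_le_mul_of_nonneg_left h hτ
      _ = _ := by ring
  -- N5: (C∂^*)(M∂^*) by parts onto the mixed difference of M
  have hN5 : |∑ x' : Site P 0, P.eta k ^ P.d * (τ * (dAdjKernel (P.eta k)⁻¹ μ' (CxiT (P.eta k)) y x' *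
      dAdjKernel (P.eta k)⁻¹ μ (Mxi P a msq k) x' y))| ≤
      |τ| * (2 * Real.exp (1 / 2) * cT) * CM * (1 + radialConst 3 δM 1 0) := by
    rw [sum_kerA_parts, abs_neg]
    exact sum_term_le₂ hPd hη hη1 hδM (p := 1) (q := 1) (i := 0) rfl (by norm_num) (by positivity) hCM.le τ y _ _ fCs gMm
  -- N6: C(∂M∂^*)
  have hN6 := sum_term_le₂ hPd hη hη1 hδM (p := 1) (q := 1) (i := 0) rfl (by norm_num) hcT0 hCM.le τ y _ _ fCv gMm
  -- the three graph sums
  have hS1 : |∑ x' : Site P 0, P.eta k ^ P.d * kerC (P.eta k) τ (Mxi P a msq k) (Mxi P a msq k) μ μ' y x'| ≤ K₁ * |τ| := by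
    refine (abs_sum_kerC_le _ _ τ _ _ μ μ' y).trans ((add_le_add hN1 hN2).trans (le_of_eq ?_))
    rw [hK₁]; ring
  have hS2 : |∑ x' : Site P 0, P.eta k ^ P.d * kerC (P.eta k) τ (Mxi P a msq k) (CxiT (P.eta k)) μ μ' y x'| ≤ K₂ * |τ| := by
    refine (abs_sum_kerC_le _ _ τ _ _ μ μ' y).trans ((add_le_add hN3 hN4).trans (le_of_eq ?_))
    rw [hK₂]; ring
  have hS3 : |∑ x' : Site P 0, P.eta k ^ P.d * kerC (P.eta k) τ (CxiT (P.eta k)) (Mxi P a msq k) μ μ' y x'| ≤ K₃ * |τ| := by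
    refine (abs_sum_kerC_le _ _ τ _ _ μ μ' y).trans ((add_le_add hN5 hN6).trans (le_of_eq ?_))
    rw [hK₃]; ring
  -- the local terms
  have hL1 : |τ * Mxi P a msq k y y| ≤ CM * |τ| := by
    rw [abs_mul, mul_comm]; exact mul_le_mul_of_nonneg_right (hM0 y y) hτ
  have hL2 : |τ * (P.eta k * dAdjKernel (P.eta k)⁻¹ μ (Mxi P a msq k) y y)| ≤ CM * |τ| := by
    have h := hMa μ y y
    rw [max_one_supDist_self, (supDist_eq_zero_iff y y).mpr rfl, Nat.cast_zero, mul_zero, mul_zero, neg_zero, Real.exp_zero,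
      mul_one, mul_one] at h
    rw [abs_mul, abs_mul, abs_of_pos hη, mul_comm]
    refine mul_le_mul_of_nonneg_right ?_ hτ
    calc P.eta k * |dAdjKernel (P.eta k)⁻¹ μ (Mxi P a msq k) y y| ≤ P.eta k * (CM * (P.eta k)⁻¹) :=
          mul_le_mul_of_nonneg_left h hη.le
      _ = CM := by field_simp
  refine ⟨hS1.trans ?_, hS2.trans ?_, hS3.trans ?_, hL1.trans ?_, hL2.trans ?_⟩ <;>
    exact mul_le_mul_of_nonneg_right (by linarith) hτ

/-! ## §3 The headline -/

/-- **THE HEADLINE: `|Π_{μμ′}[G^ξ_k(0), G^ξ_k(0), G^ξ_k(0)](y) − Π_{μμ′}[C^ξ_T, C^ξ_T, C^ξ_T](y)| ≤ Cst·|tr q²|` uniformly in the volume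
and in `1 ≤ k ≤ K`** — p. 441 *"Hence it is enough to consider the expressions with the propagator C^ξ only"* for the square-bracket
function `Π_{μμ′}` of (3.26) at the zero-field torus instance (`d = 3`): `Π[C+M] − Π[C]` is the sum of the graphs with at least
one `M` (`Pi2_add_sub`), each `≤ Cst·|τ|` (`Pi2_graphs_with_M_le`). [cite: Balaban1983Higgs3, (3.26) pp.440–441, (3.16) p.437] -/
theorem Pi2_G0xi_sub_CxiT (L : ℕ) (hL : Odd L ∧ 1 < L) {a : ℝ} (ha : 0 < a) {msq : ℝ} (hmsq : 0 ≤ msq) :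
    ∃ Cst : ℝ, 0 < Cst ∧ ∀ (P : Params), P.d = 3 → P.L = L → ∀ k : ℕ, 1 ≤ k → k ≤ P.K →
      ∀ (τ : ℝ) (μ μ' : Fin P.d) (y : Site P 0),
        |Pi2 (P.eta k) τ (G0xi P a msq k) (G0xi P a msq k) (G0xi P a msq k) μ μ' y -
            Pi2 (P.eta k) τ (CxiT (P.eta k)) (CxiT (P.eta k)) (CxiT (P.eta k)) μ μ' y| ≤ Cst * |τ| := by
  obtain ⟨Cst, hCst, H⟩ := Pi2_graphs_with_M_le L hL ha hmsq
  refine ⟨5 * Cst, by positivity, fun P hPd hPL k hk1 hkK τ μ μ' y => ?_⟩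
  obtain ⟨h1, h2, h3, h4, h5⟩ := H P hPd hPL k hk1 hkK τ μ μ' y
  rw [G0xi_eq_add, Pi2_add_sub]
  have hl4 : |(if μ = μ' then τ * Mxi P a msq k y y else 0)| ≤ Cst * |τ| := by
    split_ifs
    · exact h4
    · rw [abs_zero]; positivity
  have hl5 : |(if μ = μ' then τ * (P.eta k * dAdjKernel (P.eta k)⁻¹ μ (Mxi P a msq k) y y) else 0)| ≤ Cst * |τ| := by
    split_ifs
    · exact h5
    · rw [abs_zero]; positivity
  calc _ ≤ Cst * |τ| + Cst * |τ| + Cst * |τ| + Cst * |τ| + Cst * |τ| := by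
        refine (abs_sub _ _).trans (add_le_add ((abs_sub _ _).trans (add_le_add ?_ hl4)) hl5)
        exact (abs_add_le _ _).trans (add_le_add ((abs_add_le _ _).trans (add_le_add h1 h2)) h3)
    _ = 5 * Cst * |τ| := by ring

/-- **The other configurations by bilinearity**: with `G = C + M`, the graph sums `[M,G]`, `[G,M]` and the difference `[G,G] − [C,C]`
are sums of the three basic ones, hence also `≤ Cst·|τ|`. [cite: Balaban1983Higgs3, (3.26) pp.440–441] -/
theorem Pi2_graphs_with_M_le' (L : ℕ) (hL : Odd L ∧ 1 < L) {a : ℝ} (ha : 0 < a) {msq : ℝ} (hmsq : 0 ≤ msq) :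
    ∃ Cst : ℝ, 0 < Cst ∧ ∀ (P : Params), P.d = 3 → P.L = L → ∀ k : ℕ, 1 ≤ k → k ≤ P.K →
      ∀ (τ : ℝ) (μ μ' : Fin P.d) (y : Site P 0),
        |∑ x' : Site P 0, P.eta k ^ P.d * kerC (P.eta k) τ (Mxi P a msq k) (G0xi P a msq k) μ μ' y x'| ≤ Cst * |τ| ∧
        |∑ x' : Site P 0, P.eta k ^ P.d * kerC (P.eta k) τ (G0xi P a msq k) (Mxi P a msq k) μ μ' y x'| ≤ Cst * |τ| ∧
        |(∑ x' : Site P 0, P.eta k ^ P.d * kerC (P.eta k) τ (G0xi P a msq k) (G0xi P a msq k) μ μ' y x') -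
            ∑ x' : Site P 0, P.eta k ^ P.d * kerC (P.eta k) τ (CxiT (P.eta k)) (CxiT (P.eta k)) μ μ' y x'| ≤ Cst * |τ| := by
  obtain ⟨Cst, hCst, H⟩ := Pi2_graphs_with_M_le L hL ha hmsq
  refine ⟨3 * Cst, by positivity, fun P hPd hPL k hk1 hkK τ μ μ' y => ?_⟩
  obtain ⟨h1, h2, h3, -, -⟩ := H P hPd hPL k hk1 hkK τ μ μ' y
  have hτ : 0 ≤ Cst * |τ| := by positivity
  refine ⟨?_, ?_, ?_⟩
  · rw [G0xi_eq_add, sum_kerC_add_right]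
    calc _ ≤ Cst * |τ| + Cst * |τ| := (abs_add_le _ _).trans (add_le_add h2 h1)
      _ ≤ 3 * Cst * |τ| := by linarith
  · rw [G0xi_eq_add, sum_kerC_add_left]
    calc _ ≤ Cst * |τ| + Cst * |τ| := (abs_add_le _ _).trans (add_le_add h3 h1)
      _ ≤ 3 * Cst * |τ| := by linarith
  · rw [G0xi_eq_add, sum_kerC_add_left, sum_kerC_add_right, sum_kerC_add_right]
    have : (∑ x' : Site P 0, P.eta k ^ P.d * kerC (P.eta k) τ (CxiT (P.eta k)) (CxiT (P.eta k)) μ μ' y x') +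
        (∑ x' : Site P 0, P.eta k ^ P.d * kerC (P.eta k) τ (CxiT (P.eta k)) (Mxi P a msq k) μ μ' y x') +
        ((∑ x' : Site P 0, P.eta k ^ P.d * kerC (P.eta k) τ (Mxi P a msq k) (CxiT (P.eta k)) μ μ' y x') +
          ∑ x' : Site P 0, P.eta k ^ P.d * kerC (P.eta k) τ (Mxi P a msq k) (Mxi P a msq k) μ μ' y x') -
        ∑ x' : Site P 0, P.eta k ^ P.d * kerC (P.eta k) τ (CxiT (P.eta k)) (CxiT (P.eta k)) μ μ' y x' =
      (∑ x' : Site P 0, P.eta k ^ P.d * kerC (P.eta k) τ (CxiT (P.eta k)) (Mxi P a msq k) μ μ' y x') +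
        ((∑ x' : Site P 0, P.eta k ^ P.d * kerC (P.eta k) τ (Mxi P a msq k) (CxiT (P.eta k)) μ μ' y x') +
          ∑ x' : Site P 0, P.eta k ^ P.d * kerC (P.eta k) τ (Mxi P a msq k) (Mxi P a msq k) μ μ' y x') := by ring
    rw [this]
    calc _ ≤ Cst * |τ| + (Cst * |τ| + Cst * |τ|) :=
          (abs_add_le _ _).trans (add_le_add h3 ((abs_add_le _ _).trans (add_le_add h2 h1)))
      _ = 3 * Cst * |τ| := by ring

end

end Literature.MathematicalPhysics.QuantumFieldTheory.Balaban1983to89.B3Pi2CrossTermsZeroTorus
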